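import Summits.QuantumFields.YangMills.Theorems.UnitScaleTiltProp7PinnedFlatCoercivitySrc
import Summits.QuantumFields.YangMills.Theorems.UnitScaleTiltProp7PointPinnedPoincare
import HarnessLib

/-!
# N8 (file 3 of 3) — THE LINEAR FLAT CORE OF STUB (P) WITH ALL THREE SOURCES (curl, averaging, off-centre divergence):
# `Σ_b ‖Y(b)‖²_F ≤ 2C₁·(L^k)²·Σ_p ‖(∂Y)(p)‖²_F + 56·L^k·Σ_c ‖(Q^{(k)}Y)(c)‖²_F + 2C_pin·(L^k)³·Σ_x ‖g(x)‖²_F` whenever `∂^*Y = g` OFF the `k`-centres —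
# NO hypothesis on `Y` (route R of crux K1 «MinimiserStabilityRegPr», stmt-QuantumFields-19200; W-SEAT MAP #3 row M8 «N8 = N7-inhomogeneous»;
cell `ym3-torus`, width seat `ym-ust-19200-w1` g5 = routeR-w1; `--supports stmt-QuantumFields-19200 --as helper`, count-neutral)

YM₃ on T³ is a RUNG of the ladder (R3), not the Clay problem; nothing here claims the stub, the crux or the gap.

WHY / SHAPE.  MAP #3 displayed `C₂(L^k)²·Σ_{x∉centres}‖∂^*Y(x)‖²`; the power is `(L^k)³` (point capacity in `d = 3`: `Y = ∂u`, `u` the block-periodic Green's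
function with pole at the centre, has `∂Y = 0`, `Q^{(k)}Y = 0`, `Σ_{x ≠ c}‖∂^*Y‖² ≈ (L^k)^{−3}`, `Σ‖Y‖² ≥ g₀ > 0`), and `(L^k)³` is what is proved.  The divergence is
prescribed off the centres only, by ANY `g` agreeing with `∂^*Y` there (take `g = 1_{off}·∂^*Y` for the displayed row, `g = 0` for the pinned slice).

WHAT IS PROVED (sorry-free, no definition; `d = 3`, lattice factor `1`, `M_N(ℂ)` values, Frobenius sums, `Q^{(k)}` an abstract composite of `linAvg`):
* §1 `iterLin_sub` (the composite is additive), `iterLin_grad` (`Q^{(k)}(∂u)(c) = u(embIter k c₊) − u(embIter k c₋)`: the composite of a pure gauge is the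
  coarse gradient of its centre values — `Prop7IterLinStructureRec.iterLambda_grad` + [Balaban1984PropagatorsI] (1.20)).
* §2 `exists_dirichlet_real` (the lattice Dirichlet problem: `w = 0` on a nonempty `C`, `Δw = g` off `C` — injective ⇒ surjective on `ℝ^{T}`),
  `grad_sq_le_of_dirichlet` (`Σ(∂w)² ≤ C_pin(L)(L^k)³·Σ_x g(x)²` for `C` = the `k`-centres; file 2), `exists_dirichletCorrector` (matrix values, entrywise),
  `sum_normSq_grad_corrector_le` (Frobenius form of the energy bound).
* §3 ★★ `sum_normSq_le_curl_add_avg_add_diverg (hd : P.d = 3) (Q) (hQ0) (hQs) (Y) (hk : k ≤ m + K) (g) (hg : ∀ x ∉ Set.range (embIter k), ∂^*Y(x) = g(x))` :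
  `Σ_b‖Y(b)‖²_F ≤ 2(8400N²L⁴/(√L−1)² + 97/8)(L^k)²·Σ_p‖(∂Y)(p)‖²_F + 56L^k·Σ_c‖(Q^{(k)}Y)(c)‖²_F + 2·((1 + L³/(√L−1)²)/4)·(L^k)³·Σ_x‖g(x)‖²_F`; `…_T3`.

PROOF of §3: `Y′ := Y − ∂u` with the corrector of §2 (`u = 0` at the centres, `Δu = g` off them) is pinned (`∂^*Y′ = 0` off the centres), has the same curl
and — by §1 — the same composite average; file 1 bounds `Σ‖Y′‖²`, §2 bounds `Σ‖∂u‖²`, and `‖Y‖² ≤ 2‖Y′‖² + 2‖∂u‖²`.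
-/

set_option autoImplicit false

noncomputable section

open scoped BigOperators Matrix.Norms.L2Operator Matrix

namespace Summit.QuantumFields.YangMills.Theorems.Prop7PinnedFlatCoercivityInhom

open Literature.MathematicalPhysics.QuantumFieldTheory.Balaban1983to89
open Finset T4Continuum BlockAveraging BlockAveragingEMLLinearised LatticeFieldCalculus
open B15DeterminingSets (embIter)
open B10StarCount (sum_pbond)
open B5Eq120IterProof (bondAvgIter_grad)
open B6Eq28LandauGaugeV1 (laplace_add laplace_smul)
open Summit.QuantumFields.YangMills.Theorems.Prop7AvgLinearisation (linAvg_sub)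
open Summit.QuantumFields.YangMills.Theorems.Prop7IterLinStructureRec (exists_iterLambda_eq iterLambda_grad)
open Summit.QuantumFields.YangMills.Theorems.Prop7PinnedHodgeSplit (sum_mul_laplace_self const_of_grad_eq_zero)
open Summit.QuantumFields.YangMills.Theorems.Prop7MatrixHodgeSplit (re_laplace_apply im_laplace_apply re_grad_apply im_grad_apply normSq_eq_re_sq_add_im_sq)
open Summit.QuantumFields.YangMills.Theorems.Prop7PinnedFlatCoercivity (sum_comm₃)
open Summit.QuantumFields.YangMills.Theorems.Prop7PinnedFlatCoercivitySrc (sum_normSq_le_curl_add_avg_of_pinned)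
open Summit.QuantumFields.YangMills.Theorems.Prop7PointPinnedPoincare (sum_sq_le_grad_sq_of_eq_zero_centres)

variable {P : Params}

/-! ## §1 The composite average: additivity and pure gauges -/

section Composite

variable {n : Type*} [Fintype n] [DecidableEq n] [Nonempty n]

omit [Fintype n] [DecidableEq n] [Nonempty n] in
/-- **THE COMPOSITE IS ADDITIVE**: `Q^{(i)}(Y₁ − Y₂) = Q^{(i)}Y₁ − Q^{(i)}Y₂` (induction on the level with `linAvg_sub`). [cite: Balaban1985Averaging, (124)-(125) p.36] -/
theorem iterLin_sub (Q : (i : ℕ) → (PBond P 0 → Matrix n n ℂ) → PBond P i → Matrix n n ℂ)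
    (hQ0 : ∀ Y, Q 0 Y = Y) (hQs : ∀ (i : ℕ) (Y : PBond P 0 → Matrix n n ℂ) (c : PBond P (i + 1)), Q (i + 1) Y c = linAvg (Q i Y) c)
    (Y₁ Y₂ : PBond P 0 → Matrix n n ℂ) :
    ∀ (i : ℕ) (c : PBond P i), Q i (fun b => Y₁ b - Y₂ b) c = Q i Y₁ c - Q i Y₂ c
  | 0, c => by rw [hQ0, hQ0, hQ0]
  | i + 1, c => by
    have ih : Q i (fun b => Y₁ b - Y₂ b) = fun b => Q i Y₁ b - Q i Y₂ b := funext fun b => iterLin_sub Q hQ0 hQs Y₁ Y₂ i b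
    rw [hQs, hQs, hQs, ih, linAvg_sub]

omit [Fintype n] [DecidableEq n] [Nonempty n] in
/-- **THE COMPOSITE OF A PURE GAUGE IS THE COARSE GRADIENT OF ITS CENTRE VALUES**: `Q^{(k)}(∂u)(c) = u(embIter k c₊) − u(embIter k c₋)` (`k ≤ m + K`) —
the structure theorem `Q^{(k)} = L^kQ_k − ∇Λ` with `Λ_k(∂u) = Q′_ku − u∘embIter k` and `L^kQ_k(∂u) = ∇(Q′_ku)`. In particular `Q^{(k)}(∂u) = 0` when `u`
vanishes at the `k`-centres. [cite: Balaban1984PropagatorsI, (1.18)-(1.20) pp.19-20] -/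
theorem iterLin_grad (Q : (i : ℕ) → (PBond P 0 → Matrix n n ℂ) → PBond P i → Matrix n n ℂ)
    (hQ0 : ∀ Y, Q 0 Y = Y) (hQs : ∀ (i : ℕ) (Y : PBond P 0 → Matrix n n ℂ) (c : PBond P (i + 1)), Q (i + 1) Y c = linAvg (Q i Y) c)
    (u : Site P 0 → Matrix n n ℂ) {k : ℕ} (hk : k ≤ P.m + P.K) (c : PBond P k) :
    Q k (grad 1 u) c = u (embIter k c.tgt) - u (embIter k c.src) := by
  have hg : (grad 1 u : PBond P 0 → Matrix n n ℂ) = fun b => u b.tgt - u b.src := by funext b; simp [grad]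
  obtain ⟨Λ, h0, hs, hid⟩ := exists_iterLambda_eq Q hQ0 hQs (fun b : PBond P 0 => u b.tgt - u b.src)
  have hΛ := iterLambda_grad u Λ h0 hs k hk
  have hQφ : (P.L ^ k : ℕ) • bondAvgIter k (fun b : PBond P 0 => u b.tgt - u b.src) c = siteAvgIter k u c.tgt - siteAvgIter k u c.src := by
    rw [← hg, bondAvgIter_grad k hk 1 u]
    simp only [grad, one_div]
    rw [← Nat.cast_smul_eq_nsmul ℝ, smul_smul]
    have hL : ((P.L : ℝ) ^ k) ≠ 0 := pow_ne_zero _ (Nat.cast_ne_zero.mpr P.L_pos.ne')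
    have hone : ((P.L ^ k : ℕ) : ℝ) * ((P.L : ℝ) ^ k)⁻¹ = 1 := by push_cast; exact mul_inv_cancel₀ hL
    rw [hone, one_smul]
  rw [hg, hid k hk c, hQφ, hΛ c.tgt, hΛ c.src]
  abel

end Composite

/-! ## §2 The Dirichlet corrector and its energy -/

/-- **THE LATTICE DIRICHLET PROBLEM**: for a nonempty set `C` of sites of the finest torus and any real `g` there is `w` with `w = 0` on `C` and `Δw = g` off `C`
(the map `w ↦ (w|_C, (Δw)|_{T∖C})` is an injective — energy identity + connectedness — hence surjective endomorphism of `ℝ^T`). [cite: Balaban1984PropagatorsII, (2.10)-(2.12) p.225] -/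
theorem exists_dirichlet_real (C : Set (Site P 0)) (hC : C.Nonempty) (g : Site P 0 → ℝ) :
    ∃ w : Site P 0 → ℝ, (∀ x ∈ C, w x = 0) ∧ ∀ x, x ∉ C → laplace 1 w x = g x := by
  classical
  let Φ : (Site P 0 → ℝ) →ₗ[ℝ] (Site P 0 → ℝ) :=
    { toFun := fun w x => if x ∈ C then w x else laplace 1 w x
      map_add' := fun w₁ w₂ => by
        funext x
        simp only [Pi.add_apply]
        split_ifs
        · rfl
        · rw [laplace_add, Pi.add_apply]
      map_smul' := fun a w => by
        funext x
        simp only [Pi.smul_apply, smul_eq_mul, RingHom.id_apply]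
        split_ifs
        · rfl
        · rw [laplace_smul, Pi.smul_apply, smul_eq_mul] }
  have hΦ : ∀ (w : Site P 0 → ℝ) (x : Site P 0), Φ w x = if x ∈ C then w x else laplace 1 w x := fun _ _ => rfl
  have hinj : Function.Injective Φ := by
    refine (injective_iff_map_eq_zero Φ).mpr fun w hw => ?_
    have hwC : ∀ x ∈ C, w x = 0 := fun x hx => by
      have h := congrFun hw x; rw [hΦ, if_pos hx] at h; exact h
    have hwΔ : ∀ x, x ∉ C → laplace 1 w x = 0 := fun x hx => by
      have h := congrFun hw x; rw [hΦ, if_neg hx] at h; exact h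
    have hsum : ∑ x : Site P 0, w x * laplace 1 w x = 0 := Finset.sum_eq_zero fun x _ => by
      by_cases hx : x ∈ C
      · rw [hwC x hx, zero_mul]
      · rw [hwΔ x hx, mul_zero]
    rw [sum_mul_laplace_self] at hsum
    have hgrad : ∀ b : PBond P 0, grad 1 w b = 0 := fun b =>
      pow_eq_zero_iff two_ne_zero |>.mp ((Finset.sum_eq_zero_iff_of_nonneg fun b _ => sq_nonneg (grad 1 w b)).mp hsum b (Finset.mem_univ b))
    obtain ⟨x₀, hx₀⟩ := hC
    have h0 : w default = 0 := by rw [← const_of_grad_eq_zero one_ne_zero hgrad x₀]; exact hwC x₀ hx₀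
    funext x
    rw [const_of_grad_eq_zero one_ne_zero hgrad x, h0, Pi.zero_apply]
  obtain ⟨w, hw⟩ := LinearMap.surjective_of_injective hinj (fun x => if x ∈ C then 0 else g x)
  refine ⟨w, fun x hx => ?_, fun x hx => ?_⟩
  · have h := congrFun hw x
    rw [hΦ, if_pos hx, if_pos hx] at h
    exact h
  · have h := congrFun hw x
    rw [hΦ, if_neg hx, if_neg hx] at h
    exact h

/-- **ENERGY OF A DIRICHLET CORRECTOR** (`d = 3`): if `w = 0` at the `k`-centres and `Δw = g` off them, then
`Σ_b (∂w)(b)² ≤ ((1 + L³/(√L−1)²)/4)·(L^k)³·Σ_x g(x)²` — `Σ(∂w)² = Σ_x w·Δw = Σ_x w·g` (the centre terms vanish), Cauchy–Schwarz, and the point-pinned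
Poincaré inequality of file 2. [folklore] -/
theorem grad_sq_le_of_dirichlet (hd : P.d = 3) {k : ℕ} (hk : k ≤ P.m + P.K) (w g : Site P 0 → ℝ)
    (hw0 : ∀ y : Site P k, w (embIter k y) = 0) (hwg : ∀ x : Site P 0, x ∉ Set.range (embIter k) → laplace 1 w x = g x) :
    ∑ b : PBond P 0, grad 1 w b ^ 2
      ≤ (1 + (P.L : ℝ) ^ 3 / (Real.sqrt P.L - 1) ^ 2) / 4 * ((P.L : ℝ) ^ k) ^ 3 * ∑ x : Site P 0, g x ^ 2 := by
  classical
  set Cp : ℝ := (1 + (P.L : ℝ) ^ 3 / (Real.sqrt P.L - 1) ^ 2) / 4 * ((P.L : ℝ) ^ k) ^ 3 with hCp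
  have hL1 : (1 : ℝ) < P.L := by exact_mod_cast P.hL.2
  have hs1 : 1 < Real.sqrt P.L := by
    rw [show (1 : ℝ) = Real.sqrt 1 from Real.sqrt_one.symm]
    exact Real.sqrt_lt_sqrt zero_le_one hL1
  have hsp : 0 < Real.sqrt P.L - 1 := sub_pos.mpr hs1
  have hCp0 : 0 ≤ Cp := by positivity
  set D : ℝ := ∑ b : PBond P 0, grad 1 w b ^ 2 with hD
  set G : ℝ := ∑ x : Site P 0, g x ^ 2 with hG
  have hG0 : 0 ≤ G := Finset.sum_nonneg fun _ _ => sq_nonneg _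
  have hD0 : 0 ≤ D := Finset.sum_nonneg fun _ _ => sq_nonneg _
  -- the energy identity with the centre terms removed
  have hid : D = ∑ x : Site P 0, w x * g x := by
    rw [hD, ← sum_mul_laplace_self]
    refine Finset.sum_congr rfl fun x _ => ?_
    by_cases hx : x ∈ Set.range (embIter k)
    · obtain ⟨y, rfl⟩ := hx
      rw [hw0, zero_mul, zero_mul]
    · rw [hwg x hx]
  -- Cauchy–Schwarz and the point-pinned Poincaré inequality
  have hCS : D ^ 2 ≤ (∑ x : Site P 0, w x ^ 2) * G := by
    rw [hid]
    exact sum_mul_sq_le_sq_mul_sq univ w g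
  have hPP : ∑ x : Site P 0, w x ^ 2 ≤ Cp * D := sum_sq_le_grad_sq_of_eq_zero_centres hd hk w hw0
  have hDD : D * D ≤ Cp * G * D := by
    calc D * D = D ^ 2 := (sq D).symm
      _ ≤ (∑ x : Site P 0, w x ^ 2) * G := hCS
      _ ≤ Cp * D * G := mul_le_mul_of_nonneg_right hPP hG0
      _ = Cp * G * D := by ring
  rcases hD0.eq_or_lt with hD00 | hDpos
  · rw [← hD00]; positivity
  · exact le_of_mul_le_mul_right hDD hDpos

variable {N : ℕ}

/-- **THE MATRIX DIRICHLET CORRECTOR**: for every `M_N(ℂ)`-valued `g` there is `u` with `u = 0` at the `k`-centres and `Δu = g` off them (entrywise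
`exists_dirichlet_real`, reassembled). [cite: Balaban1984PropagatorsII, (2.10)-(2.12) p.225] -/
theorem exists_dirichletCorrector (k : ℕ) (g : Site P 0 → Matrix (Fin N) (Fin N) ℂ) :
    ∃ u : Site P 0 → Matrix (Fin N) (Fin N) ℂ,
      (∀ y : Site P k, u (embIter k y) = 0) ∧ ∀ x : Site P 0, x ∉ Set.range (embIter k) → laplace 1 u x = g x := by
  have hC : (Set.range (embIter (P := P) k)).Nonempty := ⟨embIter k default, ⟨default, rfl⟩⟩
  choose wR hwR0 hwR using fun a b : Fin N => exists_dirichlet_real (Set.range (embIter (P := P) k)) hC (fun x => ((g x) a b).re)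
  choose wI hwI0 hwI using fun a b : Fin N => exists_dirichlet_real (Set.range (embIter (P := P) k)) hC (fun x => ((g x) a b).im)
  refine ⟨fun x => Matrix.of fun a b => (⟨wR a b x, wI a b x⟩ : ℂ), fun y => ?_, fun x hx => ?_⟩
  · ext a b
    simp only [Matrix.of_apply, Matrix.zero_apply]
    apply Complex.ext
    · exact hwR0 a b _ ⟨y, rfl⟩
    · exact hwI0 a b _ ⟨y, rfl⟩
  · ext a b
    apply Complex.ext
    · rw [re_laplace_apply]
      exact hwR a b x hx
    · rw [im_laplace_apply]
      exact hwI a b x hx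

/-- **FROBENIUS ENERGY OF THE MATRIX CORRECTOR** (`d = 3`): `u = 0` at the `k`-centres and `Δu = g` off them give
`Σ_b ‖(∂u)(b)‖²_F ≤ ((1 + L³/(√L−1)²)/4)·(L^k)³·Σ_x ‖g(x)‖²_F` (entrywise `grad_sq_le_of_dirichlet`). [folklore] -/
theorem sum_normSq_grad_corrector_le (hd : P.d = 3) {k : ℕ} (hk : k ≤ P.m + P.K) (u g : Site P 0 → Matrix (Fin N) (Fin N) ℂ)
    (hu0 : ∀ y : Site P k, u (embIter k y) = 0) (hug : ∀ x : Site P 0, x ∉ Set.range (embIter k) → laplace 1 u x = g x) :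
    ∑ b : PBond P 0, ∑ a : Fin N, ∑ b' : Fin N, Complex.normSq ((grad 1 u b) a b')
      ≤ (1 + (P.L : ℝ) ^ 3 / (Real.sqrt P.L - 1) ^ 2) / 4 * ((P.L : ℝ) ^ k) ^ 3 *
          ∑ x : Site P 0, ∑ a : Fin N, ∑ b' : Fin N, Complex.normSq ((g x) a b') := by
  set Cp : ℝ := (1 + (P.L : ℝ) ^ 3 / (Real.sqrt P.L - 1) ^ 2) / 4 * ((P.L : ℝ) ^ k) ^ 3 with hCp
  -- per entry, real and imaginary parts
  have hR : ∀ a b' : Fin N, ∑ e : PBond P 0, ((grad 1 u e) a b').re ^ 2 ≤ Cp * ∑ x : Site P 0, ((g x) a b').re ^ 2 := by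
    intro a b'
    simp only [re_grad_apply]
    refine grad_sq_le_of_dirichlet hd hk (fun x => ((u x) a b').re) (fun x => ((g x) a b').re) (fun y => ?_) (fun x hx => ?_)
    · simp only [hu0 y, Matrix.zero_apply, Complex.zero_re]
    · rw [← re_laplace_apply, hug x hx]
  have hI : ∀ a b' : Fin N, ∑ e : PBond P 0, ((grad 1 u e) a b').im ^ 2 ≤ Cp * ∑ x : Site P 0, ((g x) a b').im ^ 2 := by
    intro a b'
    simp only [im_grad_apply]
    refine grad_sq_le_of_dirichlet hd hk (fun x => ((u x) a b').im) (fun x => ((g x) a b').im) (fun y => ?_) (fun x hx => ?_)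
    · simp only [hu0 y, Matrix.zero_apply, Complex.zero_im]
    · rw [← im_laplace_apply, hug x hx]
  rw [sum_comm₃ (fun (e : PBond P 0) (a b' : Fin N) => Complex.normSq ((grad 1 u e) a b')),
    sum_comm₃ (fun (x : Site P 0) (a b' : Fin N) => Complex.normSq ((g x) a b')), Finset.mul_sum]
  refine Finset.sum_le_sum fun a _ => ?_
  rw [Finset.mul_sum]
  refine Finset.sum_le_sum fun b' _ => ?_
  simp only [normSq_eq_re_sq_add_im_sq, Finset.sum_add_distrib, mul_add]
  exact add_le_add (hR a b') (hI a b')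

/-! ## §3 The three-source statement -/

/-- `|z + w|² ≤ 2|z|² + 2|w|²`. [folklore] -/
theorem normSq_add_le (z w : ℂ) : Complex.normSq (z + w) ≤ 2 * Complex.normSq z + 2 * Complex.normSq w := by
  simp only [normSq_eq_re_sq_add_im_sq, Complex.add_re, Complex.add_im]
  nlinarith [sq_nonneg (z.re - w.re), sq_nonneg (z.im - w.im)]

/-- ★★ **P-LIN-FLAT WITH CURL, AVERAGING AND DIVERGENCE SOURCES** (`d = 3`, `k ≤ m + K`; NO hypothesis on `Y`): for every `M_N(ℂ)`-valued bond field `Y`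
on the finest torus, every composite `Q^{(k)}` of the linearised average, and every `g` with `∂^*Y(x) = g(x)` at all sites `x` off the `k`-centres,
`Σ_b‖Y(b)‖²_F ≤ 2(8400N²L⁴/(√L−1)² + 97/8)(L^k)²·Σ_p‖(∂Y)(p)‖²_F + 56L^k·Σ_c‖(Q^{(k)}Y)(c)‖²_F + 2·((1 + L³/(√L−1)²)/4)·(L^k)³·Σ_x‖g(x)‖²_F`.
The powers `(L^k)²`, `L^k`, `(L^k)³` are each sharp. [cite: Balaban1984PropagatorsI, Prop. 1.1 (1.90) p.33; Balaban1985Variational, Prop. 7 p.299, (141)-(143) p.299] -/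
theorem sum_normSq_le_curl_add_avg_add_diverg (hd : P.d = 3) [NeZero N]
    (Q : (i : ℕ) → (PBond P 0 → Matrix (Fin N) (Fin N) ℂ) → PBond P i → Matrix (Fin N) (Fin N) ℂ)
    (hQ0 : ∀ Y, Q 0 Y = Y)
    (hQs : ∀ (i : ℕ) (Y : PBond P 0 → Matrix (Fin N) (Fin N) ℂ) (c : PBond P (i + 1)), Q (i + 1) Y c = linAvg (Q i Y) c)
    (Y : PBond P 0 → Matrix (Fin N) (Fin N) ℂ) {k : ℕ} (hk : k ≤ P.m + P.K)
    (g : Site P 0 → Matrix (Fin N) (Fin N) ℂ) (hg : ∀ x : Site P 0, x ∉ Set.range (embIter k) → diverg 1 Y x = g x) :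
    ∑ b : PBond P 0, ∑ a : Fin N, ∑ b' : Fin N, Complex.normSq ((Y b) a b')
      ≤ 2 * ((8400 * (N : ℝ) ^ 2 * (P.L : ℝ) ^ 4 / (Real.sqrt P.L - 1) ^ 2 + 97 / 8) * ((P.L : ℝ) ^ k) ^ 2
            * ∑ p : Plaq P 0, ∑ a : Fin N, ∑ b' : Fin N, Complex.normSq ((curl 1 Y p) a b'))
        + 56 * (P.L : ℝ) ^ k * ∑ c : PBond P k, ∑ a : Fin N, ∑ b' : Fin N, Complex.normSq ((Q k Y c) a b')
        + 2 * ((1 + (P.L : ℝ) ^ 3 / (Real.sqrt P.L - 1) ^ 2) / 4 * ((P.L : ℝ) ^ k) ^ 3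
            * ∑ x : Site P 0, ∑ a : Fin N, ∑ b' : Fin N, Complex.normSq ((g x) a b')) := by
  classical
  -- the corrector and the pinned field `Y′ = Y − ∂u`
  obtain ⟨u, hu0, hug⟩ := exists_dirichletCorrector (P := P) k g
  have hpin : ∀ x : Site P 0, x ∉ Set.range (embIter k) → diverg 1 (fun e => Y e - grad 1 u e) x = 0 := fun x hx => by
    have h : diverg 1 (fun e => Y e - grad 1 u e) x = diverg 1 Y x - laplace 1 u x := congrFun (diverg_gaugeShift (1 : ℝ) u Y) x
    rw [h, hug x hx, hg x hx, sub_self]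
  -- same curl, same composite average
  have hcurl : ∀ p : Plaq P 0, curl 1 (fun e => Y e - grad 1 u e) p = curl 1 Y p := fun p => curl_gaugeShift 1 1 u Y p
  have havg : ∀ c : PBond P k, Q k (fun e => Y e - grad 1 u e) c = Q k Y c := fun c => by
    rw [iterLin_sub Q hQ0 hQs Y (grad 1 u) k c, iterLin_grad Q hQ0 hQs u hk c, hu0, hu0, sub_zero, sub_zero]
  -- file 1 on `Y′`, §2 on `∂u`
  have h1 := sum_normSq_le_curl_add_avg_of_pinned hd Q hQ0 hQs (fun e => Y e - grad 1 u e) hk hpin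
  simp only [hcurl, havg] at h1
  have h2 := sum_normSq_grad_corrector_le hd hk u g hu0 hug
  -- `‖Y‖² ≤ 2‖Y′‖² + 2‖∂u‖²`
  have h3 : ∑ b : PBond P 0, ∑ a : Fin N, ∑ b' : Fin N, Complex.normSq ((Y b) a b')
      ≤ 2 * ∑ b : PBond P 0, ∑ a : Fin N, ∑ b' : Fin N, Complex.normSq ((Y b - grad 1 u b) a b')
        + 2 * ∑ b : PBond P 0, ∑ a : Fin N, ∑ b' : Fin N, Complex.normSq ((grad 1 u b) a b') := by
    rw [Finset.mul_sum, Finset.mul_sum, ← Finset.sum_add_distrib]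
    refine Finset.sum_le_sum fun e _ => ?_
    rw [Finset.mul_sum, Finset.mul_sum, ← Finset.sum_add_distrib]
    refine Finset.sum_le_sum fun a _ => ?_
    rw [Finset.mul_sum, Finset.mul_sum, ← Finset.sum_add_distrib]
    refine Finset.sum_le_sum fun b' _ => ?_
    have he : (Y e) a b' = (Y e - grad 1 u e) a b' + (grad 1 u e) a b' := by
      simp only [Matrix.sub_apply, sub_add_cancel]
    rw [he]
    exact normSq_add_le _ _
  have h1' := mul_le_mul_of_nonneg_left h1 (by norm_num : (0 : ℝ) ≤ 2)
  have h2' := mul_le_mul_of_nonneg_left h2 (by norm_num : (0 : ℝ) ≤ 2)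
  linarith [h3, h1', h2']

/-- ★ **THE T³ INSTANCE** (run `K` of a T³ family, comparison height `n`, `k = K − n`, `d = 3`), NO hypothesis on `Y`: for every `g` agreeing with `∂^*Y`
off the `(K−n)`-centres,
`Σ_b‖Y(b)‖²_F ≤ 2(8400N²L⁴/(√L−1)² + 97/8)L^{2(K−n)}·Σ_p‖(∂Y)(p)‖²_F + 56L^{K−n}·Σ_c‖(Q^{(K−n)}Y)(c)‖²_F + 2·((1 + L³/(√L−1)²)/4)·L^{3(K−n)}·Σ_x‖g(x)‖²_F`,
uniformly in `m`, `n`, `K`. [cite: Balaban1984PropagatorsI, Prop. 1.1 (1.90) p.33; Balaban1985Variational, Prop. 7 p.299] -/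
theorem sum_normSq_le_curl_add_avg_add_diverg_T3 (F : T3ContinuumYM3Torus.T3Family) (K n : ℕ) [NeZero N]
    (Q : (i : ℕ) → (PBond (F.P K) 0 → Matrix (Fin N) (Fin N) ℂ) → PBond (F.P K) i → Matrix (Fin N) (Fin N) ℂ)
    (hQ0 : ∀ Y, Q 0 Y = Y)
    (hQs : ∀ (i : ℕ) (Y : PBond (F.P K) 0 → Matrix (Fin N) (Fin N) ℂ) (c : PBond (F.P K) (i + 1)), Q (i + 1) Y c = linAvg (Q i Y) c)
    (Y : PBond (F.P K) 0 → Matrix (Fin N) (Fin N) ℂ)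
    (g : Site (F.P K) 0 → Matrix (Fin N) (Fin N) ℂ) (hg : ∀ x : Site (F.P K) 0, x ∉ Set.range (embIter (K - n)) → diverg 1 Y x = g x) :
    ∑ b : PBond (F.P K) 0, ∑ a : Fin N, ∑ b' : Fin N, Complex.normSq ((Y b) a b')
      ≤ 2 * ((8400 * (N : ℝ) ^ 2 * (F.L : ℝ) ^ 4 / (Real.sqrt F.L - 1) ^ 2 + 97 / 8) * ((F.L : ℝ) ^ (K - n)) ^ 2
            * ∑ p : Plaq (F.P K) 0, ∑ a : Fin N, ∑ b' : Fin N, Complex.normSq ((curl 1 Y p) a b'))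
        + 56 * (F.L : ℝ) ^ (K - n) * ∑ c : PBond (F.P K) (K - n), ∑ a : Fin N, ∑ b' : Fin N, Complex.normSq ((Q (K - n) Y c) a b')
        + 2 * ((1 + (F.L : ℝ) ^ 3 / (Real.sqrt F.L - 1) ^ 2) / 4 * ((F.L : ℝ) ^ (K - n)) ^ 3
            * ∑ x : Site (F.P K) 0, ∑ a : Fin N, ∑ b' : Fin N, Complex.normSq ((g x) a b')) := by
  have hk : K - n ≤ (F.P K).m + (F.P K).K := by
    have := F.hm
    show K - n ≤ F.m + K
    omega
  exact sum_normSq_le_curl_add_avg_add_diverg (P := F.P K) (T3ContinuumYM3Torus.T3Family.P_d F K) Q hQ0 hQs Y hk g hg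

end Summit.QuantumFields.YangMills.Theorems.Prop7PinnedFlatCoercivityInhom

end
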